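import Summits.QuantumFields.QCD.Theorems.HeatSlicedQuarksQuarkLoopCoefficientHeatSeries

/-!
# Exponential-series heat kernels on `ℤ⁴`, part B: the series and the heat equations
(line `Sketch` of crux stmt-QuantumFields-16786, shared layer; continuation of
`HeatSlicedQuarksQuarkLoopCoefficientHeatSeries`)

For a link field `u` with `‖u e‖ ≤ 1`: the exponential series `heatKer u t x y = Σₙ (−t)ⁿ/n! Hⁿ(x,y)` —
entrywise summability and `HasSum`, the value `δ` at `t = 0`, the crude bound `exp(R|t|)`, and the two heat
equations `∂_t K = −H K = −K H` as entrywise `HasDerivAt` statements (termwise differentiation on `(−T, T)`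
via `hasDerivAt_tsum_of_isPreconnected`).
-/

noncomputable section

namespace Summit.QuantumFields.QCD.Cruxes.QuarkLoopCoefficient.Sketch.HeatSeries

open Literature.MathematicalPhysics.QuantumLattice Literature.MathematicalPhysics.QuantumFieldTheory
open Literature.Probability.LatticeModels (Site)
open Summit.QuantumFields.QCD.Theorems.QuarkLoopCoefficient
open scoped Matrix ComplexConjugate

variable {u : LGConfig 4 ℂ}

/-! ## §4 The exponential series -/

/-- The scalar coefficient `(−t)ⁿ/n!` of the series, as a complex number. -/
theorem coeff_eq (t : ℝ) (n : ℕ) :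
    ((((-t) ^ n / (n.factorial : ℝ) : ℝ)) : ℂ) = ((-(t : ℂ)) ^ n / (n.factorial : ℂ)) := by
  push_cast; ring

/-- Norm of the series coefficient. -/
theorem norm_coeff (t : ℝ) (n : ℕ) :
    ‖((((-t) ^ n / (n.factorial : ℝ) : ℝ)) : ℂ)‖ = |t| ^ n / (n.factorial : ℝ) := by
  rw [Complex.norm_real, Real.norm_eq_abs, abs_div, abs_pow, abs_neg,
    abs_of_nonneg (by positivity : (0:ℝ) ≤ (n.factorial : ℝ))]

/-- The entrywise terms of the exponential series are summable. -/
theorem summable_heatKer_term (hu : ∀ e, ‖u e‖ ≤ 1) (t : ℝ) (x y : Site 4) (α β : Fin 4) :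
    Summable (fun n : ℕ => ((((-t) ^ n / (n.factorial : ℝ) : ℝ)) : ℂ) * sqKerPow u n x y α β) := by
  refine Summable.of_norm_bounded (g := fun n : ℕ => (|t| * 1679616) ^ n / (n.factorial : ℝ))
    (Real.summable_pow_div_factorial _) fun n => ?_
  rw [norm_mul, norm_coeff, mul_pow, mul_div_right_comm]
  exact mul_le_mul_of_nonneg_left (norm_sqKerPow_le hu n x y α β) (by positivity)

/-- The matrix-valued terms of the exponential series are summable (product topology). -/
theorem summable_heatKer_smul (hu : ∀ e, ‖u e‖ ≤ 1) (t : ℝ) (x y : Site 4) :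
    Summable (fun n : ℕ => (((((-t) ^ n / (n.factorial : ℝ) : ℝ)) : ℂ) • sqKerPow u n x y)) := by
  have h : ∀ α β : Fin 4, Summable (fun n : ℕ =>
      (((((-t) ^ n / (n.factorial : ℝ) : ℝ)) : ℂ) • sqKerPow u n x y) α β) := fun α β => by
    simpa only [Matrix.smul_apply, smul_eq_mul] using summable_heatKer_term hu t x y α β
  exact Pi.summable.mpr fun α => Pi.summable.mpr fun β => h α β

/-- The heat kernel entry as a scalar series (evaluation commutes with the matrix `tsum`). -/
theorem heatKer_apply (hu : ∀ e, ‖u e‖ ≤ 1) (t : ℝ) (x y : Site 4) (α β : Fin 4) :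
    heatKer u t x y α β = ∑' n : ℕ, ((((-t) ^ n / (n.factorial : ℝ) : ℝ)) : ℂ) * sqKerPow u n x y α β := by
  unfold heatKer
  have hs := summable_heatKer_smul hu t x y
  have e1 : (∑' n : ℕ, (((((-t) ^ n / (n.factorial : ℝ) : ℝ)) : ℂ) • sqKerPow u n x y)) α =
      ∑' n : ℕ, (((((-t) ^ n / (n.factorial : ℝ) : ℝ)) : ℂ) • sqKerPow u n x y) α := tsum_apply hs
  have e2 : (∑' n : ℕ, (((((-t) ^ n / (n.factorial : ℝ) : ℝ)) : ℂ) • sqKerPow u n x y) α) β =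
      ∑' n : ℕ, (((((-t) ^ n / (n.factorial : ℝ) : ℝ)) : ℂ) • sqKerPow u n x y) α β :=
    tsum_apply (Pi.summable.mp hs α)
  rw [show (∑' n : ℕ, (((((-t) ^ n / (n.factorial : ℝ) : ℝ)) : ℂ) • sqKerPow u n x y)) α β =
      ((∑' n : ℕ, (((((-t) ^ n / (n.factorial : ℝ) : ℝ)) : ℂ) • sqKerPow u n x y)) α) β from rfl, e1, e2]
  simp only [Matrix.smul_apply, smul_eq_mul]

/-- The entrywise `HasSum` form of the exponential series. -/
theorem hasSum_heatKer_apply (hu : ∀ e, ‖u e‖ ≤ 1) (t : ℝ) (x y : Site 4) (α β : Fin 4) :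
    HasSum (fun n : ℕ => ((((-t) ^ n / (n.factorial : ℝ) : ℝ)) : ℂ) * sqKerPow u n x y α β)
      (heatKer u t x y α β) := by
  rw [heatKer_apply hu]
  exact (summable_heatKer_term hu t x y α β).hasSum

/-- At `t = 0` the heat kernel is the identity kernel. -/
theorem heatKer_zero (hu : ∀ e, ‖u e‖ ≤ 1) (x y : Site 4) :
    heatKer u 0 x y = if x = y then 1 else 0 := by
  ext α β
  rw [heatKer_apply hu, tsum_eq_single 0]
  · simp [sqKerPow_zero_apply]
  · intro n hn
    simp [zero_pow hn]

/-- Crude entry bound of the heat kernel: `‖K_t(x,y)_{αβ}‖ ≤ exp(R|t|)`. -/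
theorem norm_heatKer_apply_le (hu : ∀ e, ‖u e‖ ≤ 1) (t : ℝ) (x y : Site 4) (α β : Fin 4) :
    ‖heatKer u t x y α β‖ ≤ Real.exp (1679616 * |t|) := by
  rw [heatKer_apply hu]
  have hg : HasSum (fun n : ℕ => (1679616 * |t|) ^ n / (n.factorial : ℝ)) (Real.exp (1679616 * |t|)) := by
    rw [Real.exp_eq_exp_ℝ]
    exact NormedSpace.expSeries_div_hasSum_exp (1679616 * |t|)
  refine (norm_tsum_le_tsum_norm ?_).trans ?_
  · exact (summable_heatKer_term hu t x y α β).norm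
  · refine (Summable.tsum_le_tsum (fun n => ?_) (summable_heatKer_term hu t x y α β).norm hg.summable).trans
      (le_of_eq hg.tsum_eq)
    rw [norm_mul, norm_coeff, mul_pow, mul_comm ((1679616:ℝ) ^ n), mul_div_right_comm]
    exact mul_le_mul_of_nonneg_left (norm_sqKerPow_le hu n x y α β) (by positivity)

/-! ## §5 The heat equations (termwise differentiation) -/

/-- Derivative of the scalar coefficient: `d/dt [(−t)ⁿ⁺¹/(n+1)!] = −(−t)ⁿ/n!`. -/
theorem hasDerivAt_coeff_succ (n : ℕ) (t : ℝ) :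
    HasDerivAt (fun s : ℝ => ((((-s) ^ (n + 1) / ((n + 1).factorial : ℝ) : ℝ)) : ℂ))
      (-((((-t) ^ n / (n.factorial : ℝ) : ℝ)) : ℂ)) t := by
  -- real derivative, then cast
  have hreal : HasDerivAt (fun s : ℝ => (-s) ^ (n + 1) / ((n + 1).factorial : ℝ))
      (-((-t) ^ n / (n.factorial : ℝ))) t := by
    have h1 : HasDerivAt (fun s : ℝ => (-s) ^ (n + 1)) (((n + 1 : ℕ) : ℝ) * (-t) ^ (n + 1 - 1) * (-1)) t :=
      (hasDerivAt_pow (n + 1) (-t)).comp t (hasDerivAt_neg t)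
    have h2 := h1.div_const ((n + 1).factorial : ℝ)
    refine h2.congr_deriv ?_
    rw [Nat.add_sub_cancel, Nat.factorial_succ]
    push_cast
    field_simp
  have hc := hreal.ofReal_comp
  refine hc.congr_deriv ?_
  push_cast
  ring

/-- The constant term has zero derivative. -/
theorem hasDerivAt_coeff_zero (t : ℝ) :
    HasDerivAt (fun s : ℝ => ((((-s) ^ 0 / ((0 : ℕ).factorial : ℝ) : ℝ)) : ℂ)) 0 t := by
  simpa using hasDerivAt_const t (1 : ℂ)

/-- **Left heat equation**, entrywise: `∂_t K_t(x,y) = −Σ_{z ∈ nbr2 x} H(x,z) K_t(z,y)`. -/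
theorem hasDerivAt_heatKer_apply (hu : ∀ e, ‖u e‖ ≤ 1) (t : ℝ) (x y : Site 4) (α β : Fin 4) :
    HasDerivAt (fun s : ℝ => heatKer u s x y α β)
      (-(∑ z ∈ nbr2 x, sqKer u x z * heatKer u t z y) α β) t := by
  -- work on the open interval |s| < T := |t| + 1
  set T : ℝ := |t| + 1 with hT
  have htT : t ∈ Set.Ioo (-T) T := by
    constructor <;> [have := neg_abs_le t; have := le_abs_self t] <;> linarith
  -- the terms, their derivatives and the uniform bound on the interval
  set f : ℕ → ℝ → ℂ := fun n s => ((((-s) ^ n / (n.factorial : ℝ) : ℝ)) : ℂ) * sqKerPow u n x y α β with hf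
  set f' : ℕ → ℝ → ℂ := fun n s => match n with
    | 0 => 0
    | (m + 1) => -((((-s) ^ m / (m.factorial : ℝ) : ℝ)) : ℂ) * sqKerPow u (m + 1) x y α β with hf'
  set ubound : ℕ → ℝ := fun n => match n with
    | 0 => 0
    | (m + 1) => (T * 1679616) ^ m / (m.factorial : ℝ) * 1679616 with hub
  have hu_sum : Summable ubound := by
    have h := (Real.summable_pow_div_factorial (T * 1679616)).mul_right (1679616 : ℝ)
    refine (summable_nat_add_iff 1).mp ?_
    simpa [hub] using h
  have hderiv : ∀ (n : ℕ) (s : ℝ), s ∈ Set.Ioo (-T) T → HasDerivAt (f n) (f' n s) s := by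
    intro n s _
    cases n with
    | zero => simpa [hf, hf'] using (hasDerivAt_coeff_zero s).mul_const (sqKerPow u 0 x y α β)
    | succ m =>
      have := (hasDerivAt_coeff_succ m s).mul_const (sqKerPow u (m + 1) x y α β)
      simpa [hf, hf', neg_mul] using this
  have hbound : ∀ (n : ℕ) (s : ℝ), s ∈ Set.Ioo (-T) T → ‖f' n s‖ ≤ ubound n := by
    intro n s hs
    cases n with
    | zero => simp [hf', hub]
    | succ m =>
      simp only [hf', hub, neg_mul, norm_neg, norm_mul, norm_coeff]
      have hsT : |s| ≤ T := by
        rw [abs_le]; exact ⟨hs.1.le, hs.2.le⟩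
      calc |s| ^ m / (m.factorial : ℝ) * ‖sqKerPow u (m + 1) x y α β‖
          ≤ T ^ m / (m.factorial : ℝ) * (1679616 : ℝ) ^ (m + 1) :=
            mul_le_mul (div_le_div_of_nonneg_right (pow_le_pow_left₀ (abs_nonneg s) hsT m) (by positivity))
              (norm_sqKerPow_le hu (m + 1) x y α β) (norm_nonneg _) (by positivity)
        _ = (T * 1679616) ^ m / (m.factorial : ℝ) * 1679616 := by rw [mul_pow, pow_succ]; ring
  have hsum0 : Summable (fun n => f n t) := summable_heatKer_term hu t x y α β
  have key := hasDerivAt_tsum_of_isPreconnected hu_sum isOpen_Ioo isPreconnected_Ioo hderiv hbound htT hsum0 htT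
  -- identify the function and the derivative
  have hfun : (fun s : ℝ => ∑' n : ℕ, f n s) = fun s => heatKer u s x y α β := by
    funext s; rw [heatKer_apply hu]
  rw [hfun] at key
  have hder : ∑' n : ℕ, f' n t = -(∑ z ∈ nbr2 x, sqKer u x z * heatKer u t z y) α β := by
    -- shift the index: Σ_n f' n t = Σ_m f' (m+1) t
    have hs' : Summable (fun n => f' n t) := by
      refine Summable.of_norm_bounded hu_sum (fun n => hbound n t htT)
    rw [hs'.tsum_eq_zero_add]
    simp only [hf', zero_add]
    -- expand H^{m+1}(x,y) = Σ_z H(x,z) H^m(z,y) and swap the finite sum with the series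
    have hexp : ∀ m : ℕ, sqKerPow u (m + 1) x y α β =
        ∑ z ∈ nbr2 x, ∑ γ : Fin 4, sqKer u x z α γ * sqKerPow u m z y γ β := by
      intro m
      rw [sqKerPow_succ, Matrix.sum_apply]
      refine Finset.sum_congr rfl fun z _ => ?_
      rw [Matrix.mul_apply]
    simp_rw [neg_mul]
    rw [tsum_neg]
    congr 1
    simp_rw [hexp, Finset.mul_sum]
    rw [Matrix.sum_apply]
    -- Σ' m, Σ_z Σ_γ c_m H H^m  =  Σ_z Σ_γ H (Σ' m, c_m H^m)
    have hsm : ∀ z ∈ nbr2 x, ∀ γ : Fin 4, Summable (fun m : ℕ =>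
        ((((-t) ^ m / (m.factorial : ℝ) : ℝ)) : ℂ) * (sqKer u x z α γ * sqKerPow u m z y γ β)) := by
      intro z _ γ
      have := (summable_heatKer_term hu t z y γ β).mul_left (sqKer u x z α γ)
      refine this.congr fun m => ?_
      ring
    rw [Summable.tsum_finsetSum (fun z hz => summable_sum fun γ _ => hsm z hz γ)]
    refine Finset.sum_congr rfl fun z hz => ?_
    rw [Summable.tsum_finsetSum (fun γ _ => hsm z hz γ), Matrix.mul_apply]
    refine Finset.sum_congr rfl fun γ _ => ?_
    rw [heatKer_apply hu, ← tsum_mul_left]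
    refine tsum_congr fun m => ?_
    ring
  rw [hder] at key
  exact key

/-- **Right heat equation**, entrywise: `∂_t K_t(x,y) = −Σ_{z ∈ nbr2 y} K_t(x,z) H(z,y)`. -/
theorem hasDerivAt_heatKer_apply_right (hu : ∀ e, ‖u e‖ ≤ 1) (t : ℝ) (x y : Site 4) (α β : Fin 4) :
    HasDerivAt (fun s : ℝ => heatKer u s x y α β)
      (-(∑ z ∈ nbr2 y, heatKer u t x z * sqKer u z y) α β) t := by
  -- work on the open interval |s| < T := |t| + 1
  set T : ℝ := |t| + 1 with hT
  have htT : t ∈ Set.Ioo (-T) T := by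
    constructor <;> [have := neg_abs_le t; have := le_abs_self t] <;> linarith
  -- the terms, their derivatives and the uniform bound on the interval
  set f : ℕ → ℝ → ℂ := fun n s => ((((-s) ^ n / (n.factorial : ℝ) : ℝ)) : ℂ) * sqKerPow u n x y α β with hf
  set f' : ℕ → ℝ → ℂ := fun n s => match n with
    | 0 => 0
    | (m + 1) => -((((-s) ^ m / (m.factorial : ℝ) : ℝ)) : ℂ) * sqKerPow u (m + 1) x y α β with hf'
  set ubound : ℕ → ℝ := fun n => match n with
    | 0 => 0
    | (m + 1) => (T * 1679616) ^ m / (m.factorial : ℝ) * 1679616 with hub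
  have hu_sum : Summable ubound := by
    have h := (Real.summable_pow_div_factorial (T * 1679616)).mul_right (1679616 : ℝ)
    refine (summable_nat_add_iff 1).mp ?_
    simpa [hub] using h
  have hderiv : ∀ (n : ℕ) (s : ℝ), s ∈ Set.Ioo (-T) T → HasDerivAt (f n) (f' n s) s := by
    intro n s _
    cases n with
    | zero => simpa [hf, hf'] using (hasDerivAt_coeff_zero s).mul_const (sqKerPow u 0 x y α β)
    | succ m =>
      have := (hasDerivAt_coeff_succ m s).mul_const (sqKerPow u (m + 1) x y α β)
      simpa [hf, hf', neg_mul] using this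
  have hbound : ∀ (n : ℕ) (s : ℝ), s ∈ Set.Ioo (-T) T → ‖f' n s‖ ≤ ubound n := by
    intro n s hs
    cases n with
    | zero => simp [hf', hub]
    | succ m =>
      simp only [hf', hub, neg_mul, norm_neg, norm_mul, norm_coeff]
      have hsT : |s| ≤ T := by
        rw [abs_le]; exact ⟨hs.1.le, hs.2.le⟩
      calc |s| ^ m / (m.factorial : ℝ) * ‖sqKerPow u (m + 1) x y α β‖
          ≤ T ^ m / (m.factorial : ℝ) * (1679616 : ℝ) ^ (m + 1) :=
            mul_le_mul (div_le_div_of_nonneg_right (pow_le_pow_left₀ (abs_nonneg s) hsT m) (by positivity))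
              (norm_sqKerPow_le hu (m + 1) x y α β) (norm_nonneg _) (by positivity)
        _ = (T * 1679616) ^ m / (m.factorial : ℝ) * 1679616 := by rw [mul_pow, pow_succ]; ring
  have hsum0 : Summable (fun n => f n t) := summable_heatKer_term hu t x y α β
  have key := hasDerivAt_tsum_of_isPreconnected hu_sum isOpen_Ioo isPreconnected_Ioo hderiv hbound htT hsum0 htT
  -- identify the function and the derivative
  have hfun : (fun s : ℝ => ∑' n : ℕ, f n s) = fun s => heatKer u s x y α β := by
    funext s; rw [heatKer_apply hu]
  rw [hfun] at key
  have hder : ∑' n : ℕ, f' n t = -(∑ z ∈ nbr2 y, heatKer u t x z * sqKer u z y) α β := by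
    -- shift the index: Σ_n f' n t = Σ_m f' (m+1) t
    have hs' : Summable (fun n => f' n t) := by
      refine Summable.of_norm_bounded hu_sum (fun n => hbound n t htT)
    rw [hs'.tsum_eq_zero_add]
    simp only [hf', zero_add]
    -- expand H^{m+1}(x,y) = Σ_z H(x,z) H^m(z,y) and swap the finite sum with the series
    have hexp : ∀ m : ℕ, sqKerPow u (m + 1) x y α β =
        ∑ z ∈ nbr2 y, ∑ γ : Fin 4, sqKerPow u m x z α γ * sqKer u z y γ β := by
      intro m
      rw [sqKerPow_succ_right, Matrix.sum_apply]
      refine Finset.sum_congr rfl fun z _ => ?_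
      rw [Matrix.mul_apply]
    simp_rw [neg_mul]
    rw [tsum_neg]
    congr 1
    simp_rw [hexp, Finset.mul_sum]
    rw [Matrix.sum_apply]
    -- Σ' m, Σ_z Σ_γ c_m H H^m  =  Σ_z Σ_γ H (Σ' m, c_m H^m)
    have hsm : ∀ z ∈ nbr2 y, ∀ γ : Fin 4, Summable (fun m : ℕ =>
        ((((-t) ^ m / (m.factorial : ℝ) : ℝ)) : ℂ) * (sqKerPow u m x z α γ * sqKer u z y γ β)) := by
      intro z _ γ
      have := (summable_heatKer_term hu t x z α γ).mul_right (sqKer u z y γ β)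
      refine this.congr fun m => ?_
      ring
    rw [Summable.tsum_finsetSum (fun z hz => summable_sum fun γ _ => hsm z hz γ)]
    refine Finset.sum_congr rfl fun z hz => ?_
    rw [Summable.tsum_finsetSum (fun γ _ => hsm z hz γ), Matrix.mul_apply]
    refine Finset.sum_congr rfl fun γ _ => ?_
    rw [heatKer_apply hu, ← tsum_mul_right]
    refine tsum_congr fun m => ?_
    ring
  rw [hder] at key
  exact key

/-! ## Registered headline -/

/-- Registered headline of this helper file (aux stub `stub_heatSeriesB` of crux stmt-QuantumFields-16786, line
`Sketch`): the (left) heat equation of the exponential-series kernel, entrywise. -/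
theorem stub_heatSeriesB :
    ∀ (u : LGConfig 4 ℂ), (∀ e, ‖u e‖ ≤ 1) → ∀ (t : ℝ) (x y : Site 4) (α β : Fin 4),
      HasDerivAt (fun s : ℝ => heatKer u s x y α β) (-(∑ z ∈ nbr2 x, sqKer u x z * heatKer u t z y) α β) t :=
  fun _ hu t x y α β => hasDerivAt_heatKer_apply hu t x y α β

end Summit.QuantumFields.QCD.Cruxes.QuarkLoopCoefficient.Sketch.HeatSeries

end
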